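import Mathlib
import HarnessLib
import Summits.Parity.GeneralizedHardyLittlewood.Theses.LeeYangFibres
import Summits.Parity.GeneralizedHardyLittlewood.Theorems.LeeYangFibresFibreHyperbolicityDefs
import Summits.Parity.GeneralizedHardyLittlewood.Theorems.LeeYangFibresFibreHyperbolicityCoeffBound
import Summits.Parity.GeneralizedHardyLittlewood.Theorems.LeeYangFibresFibreHyperbolicityPerturb
import Summits.Parity.GeneralizedHardyLittlewood.Theorems.LeeYangFibresFibreHyperbolicityAssemble
import Summits.Parity.GeneralizedHardyLittlewood.Theorems.LeeYangFibresFibreHyperbolicityGhostFree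
import Summits.Parity.GeneralizedHardyLittlewood.Theorems.LeeYangFibresFibreHyperbolicityGhostFreeOne
import Summits.Parity.GeneralizedHardyLittlewood.Theorems.LeeYangFibresHyperbolicityClipsParityPrep
import Summits.Parity.GeneralizedHardyLittlewood.Theorems.LeeYangFibresCellsToRelativeDimOne

/-!
# Crux `FibreHyperbolicity` (stmt-Parity-14108), line "model transfer": what the last stub carries

The skeleton `Cruxes/FibreHyperbolicity/Lines/SketchIdeator1.lean` closes the crux modulo ONE registered stub,
`stub_ghostFree : ∀ t ≥ 2, GhostFreeCellLaw t` (the ghost-free cell law: the route's `CellParityLaw` inequality with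
Walsh amplitude `1`). This file proves the four REGISTERED RESIDUE STATEMENTS of skeleton v6, i.e. exactly what a
proof of that stub would deliver — each as an implication from the stub's statement, sorry-free:

* `stub_residueCrux   : (∀ t ≥ 2, GhostFreeCellLaw t) → FibreHyperbolicity` — the line's composition
  (`stub_assemble ∘ stub_ghostBridge`, with the landed `t = 1` law `stub_ghostFreeOne`);
* `stub_residueLaw    : (∀ t ≥ 2, GhostFreeCellLaw t) → CellParityLaw` — crux 3 of the route, with `θ = δ_∅`;
* `stub_residueCells  : (∀ t ≥ 2, GhostFreeCellLaw t) → PrimeCellsRelative` — the route's cell-level OUTPUT node,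
  directly (prime cell `j = (1,…,1)` at `u = 2`; `β_∞ 𝔖 ≥ 0`);
* `stub_residueDimOne : (∀ t ≥ 2, GhostFreeCellLaw t) → RelativeDimOne` — the route's `d = 1` OUTPUT and the
  mechanism-fed hypothesis of its deciding theorem `closes`, through the landed glue `cellsToRelativeDimOne_proof`.

Consequence for the line (recorded, not a claim about the crux): the one open stub of "model transfer" is not an
input of the route but contains its output; closing the line this way would prove `RelativeDimOne` outright and make
the crux, the clipping lemma and crux 3 unnecessary. The statements are registered stubs of the skeleton so that they
land under `--supports stmt-Parity-14108`; they assert implications only.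
-/

noncomputable section

namespace Summit.Parity.GeneralizedHardyLittlewood.Cruxes.FibreHyperbolicity.ModelTransfer

open scoped BigOperators Classical
open Finset
open Literature.NumberTheory.Sieve
open Summit.Parity.GeneralizedHardyLittlewood.Theses.LeeYangFibres
  (FibreHyperbolicity CellParityLaw PrimeCellsRelative RelativeDimOne)
open Summit.Parity.GeneralizedHardyLittlewood.Theorems.HyperbolicityClipsParity (archFactor_mul_singularProduct_nonneg)
open Summit.Parity.GeneralizedHardyLittlewood.Theorems.LeeYangFibresCells (cellsToRelativeDimOne_proof)

/-- The ghost-free cell law at every `t ≥ 1` from its `t ≥ 2` members (the `t = 1` member is the landed,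
parity-free `stub_ghostFreeOne`). -/
theorem ghostFree_all (h : ∀ t : ℕ, 2 ≤ t → GhostFreeCellLaw t) : ∀ t : ℕ, 1 ≤ t → GhostFreeCellLaw t := by
  intro t ht
  rcases Nat.lt_or_ge t 2 with h2 | h2
  · obtain rfl : t = 1 := by omega
    exact stub_ghostFreeOne
  · exact h t h2

/-- `FibreHyperbolicity` at a fixed number of forms from the ghost-free cell law at that `t` (the line's
composition: Alladi bridge `stub_ghostBridge`, then `stub_assemble` with the perturbation lemma, the coefficient
bound, the fibre expansion and the simple real zeros of the model polynomial). -/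
theorem fibreHyperbolicityAt_of_ghostFree (t : ℕ) (ht : 1 ≤ t) (h : GhostFreeCellLaw t) : FHAt t :=
  stub_assemble t ht stub_perturb stub_coeffBound fibreExpand (stub_ghostBridge t h)

/-- **Residue ⇒ crux** (registered residue statement `stub_residueCrux`): the open stub of the line implies
`FibreHyperbolicity` — the skeleton's `FibreHyperbolicity_of` with the stub as an explicit hypothesis. -/
theorem stub_residueCrux : (∀ t : ℕ, 2 ≤ t → GhostFreeCellLaw t) → FibreHyperbolicity := fun h =>
  crux_iff.mpr fun t ht => fibreHyperbolicityAt_of_ghostFree t ht (ghostFree_all h t ht)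

/-- **Residue ⇒ crux 3** (registered residue statement `stub_residueLaw`): the open stub of the line implies the
route's `CellParityLaw`, with the trivial amplitudes `θ_∅ = 1`, `θ_S = 0` (`S ≠ ∅`), whose Walsh factor is `1`. -/
theorem stub_residueLaw : (∀ t : ℕ, 2 ≤ t → GhostFreeCellLaw t) → CellParityLaw := by
  intro h t L u ht hu ε hε
  obtain ⟨N₀, hN₀⟩ := ghostFree_all h t ht L u hu ε hε
  refine ⟨N₀, fun N hN Ψ hΨ hsize K hK hKN => ⟨fun S => if S = ∅ then 1 else 0, if_pos rfl, ?_, ?_⟩⟩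
  · intro S; dsimp only; split_ifs <;> norm_num
  · intro j hj
    have hw : (∑ S : Finset (Fin t), (if S = ∅ then (1 : ℝ) else 0) * ∏ i ∈ S, (-1 : ℝ) ^ (j i + 1)) = 1 := by
      rw [Finset.sum_eq_single_of_mem (∅ : Finset (Fin t)) (Finset.mem_univ _)]
      · simp
      · intro S _ hS; simp [hS]
    rw [hw, one_mul]
    exact hN₀ N hN Ψ hΨ hsize K hK hKN j hj

/-- **Residue ⇒ the route's cell-level output** (registered residue statement `stub_residueCells`): the open stub
of the line implies `PrimeCellsRelative` directly — at `u = 2`, the prime cell `j = (1,…,1)` of the ghost-free law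
has absolute error `ε N / log^t N ≤ ε (M₁ + N / log^t N)` since `M₁ = β_∞ 𝔖 (A₁(N)/N)^t ≥ 0`. -/
theorem stub_residueCells : (∀ t : ℕ, 2 ≤ t → GhostFreeCellLaw t) → PrimeCellsRelative := by
  intro h t L ht ε hε
  obtain ⟨N₀, hN₀⟩ := ghostFree_all h t ht L 2 le_rfl ε hε
  refine ⟨2, le_rfl, N₀, fun N hN Ψ hΨ hsize K hK hKN => ?_⟩
  have key := hN₀ N hN Ψ hΨ hsize K hK hKN (fun _ => 1) (fun _ => ⟨le_rfl, by norm_num⟩)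
  simp only [jointCell, Finset.prod_const, Finset.card_univ, Fintype.card_fin] at key
  refine key.trans ?_
  rw [mul_div_assoc]
  refine mul_le_mul_of_nonneg_left ?_ hε.le
  exact le_add_of_nonneg_left (mul_nonneg (archFactor_mul_singularProduct_nonneg Ψ hΨ K)
    (pow_nonneg (div_nonneg (Nat.cast_nonneg _) (Nat.cast_nonneg _)) _))

/-- **Residue ⇒ the route's `d = 1` output** (registered residue statement `stub_residueDimOne`): the open stub of
the line implies `RelativeDimOne` — the hypothesis of the route's deciding theorem `closes` that the mechanism
feeds — through the landed glue `CellsToRelativeDimOne` (`cellsToRelativeDimOne_proof`). -/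
theorem stub_residueDimOne : (∀ t : ℕ, 2 ≤ t → GhostFreeCellLaw t) → RelativeDimOne := fun h =>
  cellsToRelativeDimOne_proof (stub_residueCells h)

end Summit.Parity.GeneralizedHardyLittlewood.Cruxes.FibreHyperbolicity.ModelTransfer

end
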